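import Summits.CriticalPhenomena.CardyFormulaZ2.Theorems.CardyIKTransportIKMixedBoxCrossingDefectDefs
import Summits.CriticalPhenomena.CardyFormulaZ2.Theorems.CardyIKTransportIKMixedBoxCrossingDefectGlueDefs
import Summits.CriticalPhenomena.CardyFormulaZ2.Theorems.CardyIKTransportIKMixedBoxCrossingDefectGlueColDefs
import Summits.CriticalPhenomena.CardyFormulaZ2.Theorems.CardyIKTransportIKMixedBoxCrossingTransportDefs
import Summits.CriticalPhenomena.CardyFormulaZ2.Theorems.CardyIKTransportIKMixedBoxCrossingDefectStubGadget
import Summits.CriticalPhenomena.CardyFormulaZ2.Theorems.CardyIKTransportIKMixedBoxCrossingDefectStubClosureMarkov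
import Summits.CriticalPhenomena.CardyFormulaZ2.Theorems.CardyIKTransportIKMixedBoxCrossingDefectStubPolymerTail
import Summits.CriticalPhenomena.CardyFormulaZ2.Theorems.CardyIKTransportIKMixedBoxCrossingStubPatternLocality
import Summits.CriticalPhenomena.CardyFormulaZ2.Theorems.CardyIKTransportIKMixedBoxCrossingStubMonotone
import Summits.CriticalPhenomena.CardyFormulaZ2.Theorems.CardyIKTransportIKMixedBoxCrossingDefectStubBridge
import Summits.CriticalPhenomena.CardyFormulaZ2.Theorems.CardyIKTransportIKMixedBoxCrossingDefectStubColFactorisation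
import Summits.CriticalPhenomena.CardyFormulaZ2.Theorems.CardyIKTransportIKMixedBoxCrossingDefectStubColGlue
import Summits.CriticalPhenomena.CardyFormulaZ2.Theorems.CardyIKTransportIKMixedBoxCrossingDefectStubGlueFirstColPos
import Summits.CriticalPhenomena.CardyFormulaZ2.Theorems.CardyIKTransportIKMixedBoxCrossingTransportVerticalClause
import Summits.CriticalPhenomena.CardyFormulaZ2.Theorems.CardyIKTransportIKMixedBoxCrossingSplit

/-!
# Line `defect-closure-exploration`, reshape v6 (lead c7): the second-moment route lands on the split child

Support file (`--supports stmt-CriticalPhenomena-5911`), crux `IKMixedBoxCrossing`.  After the typed split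
(`Theorems/CardyIKTransportIKMixedBoxCrossingSplit.lean`, p143979: `Split.VerticalClause` PROVED, the crux
`↔ Split.HorizontalClause`) the skeleton's single stub is `Split.HorizontalClause` itself.  This file records, sorry-free,
that the v3c–v5c residue — the bare column contact inequality `stub_csmColIneq` (`ContactSecondMomentCol` without its landed
positivity half) — is ONE sufficient route to that stub: the landed column junction (`ColFactorisation` p121467, `ColGluing`
p121636, positivity p124562), the landed transport of the vertical clause (`verticalClause`, p138511) and the landed structure
stubs give the crux by `mixed_of_transport` / `IKMixedBoxCrossing_of_defectStubs`, and the split hands back its horizontal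
clause.  So a prover who lands `stub_csmColIneq` closes the crux through `Split.IKMixedBoxCrossing_of_horizontal ∘` this theorem.
Nothing is asserted here beyond that implication (memo `Cruxes/IKMixedBoxCrossing/Lines/defect-closure-exploration-c7.md` §7 lists
the other candidate routes: the pure-isotropic boundary-arm package, and `TallEasyTransverse` + confinement for the easy aspect).
-/

namespace Summit.CriticalPhenomena.CardyFormulaZ2.Cruxes.IKMixedBoxCrossing.DefectClosureExploration

open Summit.CriticalPhenomena.CardyFormulaZ2.Cruxes.IKMixedBoxCrossing.PairedMirrorExploration
  (stub_patternLocality stub_monotone)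

/-- **The bare column contact inequality implies the horizontal clause of the crux** (registered composition,
sorry-free): `(∃ C > 0, ∀ S n b, 1 ≤ n → glueSecondCol S b n n ≤ C·(glueFirstCol S b n n)²) → Split.HorizontalClause`.
Positivity of the first moment is `stub_glueFirstColPos`; the junction and the transported vertical clause give
`MixedBoxCrossingFree`, hence the crux (`IKMixedBoxCrossing_of_defectStubs`), hence its horizontal clause
(`Split.clauses_of_IKMixedBoxCrossing`). -/
theorem horizontalClause_of_csmColIneq :
    (∃ C : ℝ, 0 < C ∧ ∀ (S : Set ℤ) (n : ℕ) (b : ℤ), 1 ≤ n → glueSecondCol S b n n ≤ C * glueFirstCol S b n n ^ 2) →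
      Split.HorizontalClause := by
  intro h
  have hcsm : ContactSecondMomentCol := by
    obtain ⟨C, hC, h⟩ := h
    exact ⟨C, hC, fun S n b hn => ⟨h S n b hn, stub_glueFirstColPos S n b hn⟩⟩
  have hmix : ClosureMarkov → PolymerTail → SubcriticalMaskDensity → PureIKBoxCrossing → MixedBoxCrossingFree :=
    fun _ _ _ _ => mixed_of_transport stub_bridge stub_patternLocality stub_monotone (stub_colGlue stub_colFactorisation)
      hcsm verticalClause
  exact (Split.clauses_of_IKMixedBoxCrossing
    (IKMixedBoxCrossing_of_defectStubs stub_gadget stub_closureMarkov stub_polymerTail stub_pureIK hmix stub_bridge)).2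

/-- The same route stated for the crux decl itself (CardyIKTransport copy): the bare inequality closes the crux. -/
theorem IKMixedBoxCrossing_of_csmColIneq
    (h : ∃ C : ℝ, 0 < C ∧ ∀ (S : Set ℤ) (n : ℕ) (b : ℤ), 1 ≤ n → glueSecondCol S b n n ≤ C * glueFirstCol S b n n ^ 2) :
    Summit.CriticalPhenomena.CardyFormulaZ2.Theses.CardyIKTransport.IKMixedBoxCrossing :=
  Split.IKMixedBoxCrossing_of_horizontal (horizontalClause_of_csmColIneq h)

end Summit.CriticalPhenomena.CardyFormulaZ2.Cruxes.IKMixedBoxCrossing.DefectClosureExploration
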